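import Summits.BirchSwinnertonDyer.BirchSwinnertonDyer.Theorems.PrintCFramBottomClassIndexLawFiveLeCohenCutCarlitz
import HarnessLib

/-!
# Crux `PrintCFram.BottomClassIndexLawFiveLe` (stmt-BirchSwinnertonDyer-20372), line `eisenstein-resource-bdp-line` (registry v24):
# THE CUT COHEN NUMBERS AWAY FROM `2`, part 2 — the UNTWISTED datum `m = 1` (prime conductors) and the UNIFORM MULTIPLIER `A`
# (cell `bsd-print-cfram`, width seat `bsd-line-cfram-p1-w7` g6; THEOREMS ONLY, `--supports` 20372; BSD is not proved by any of this)

HONEST FRAMING. Nothing here is a statement about BSD or about any curve; no registered stub is closed. Part 1 (`…CohenCutCarlitz`)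
proved `‖H(k, a)‖_ℓ ≤ 1` at every odd prime `ℓ` on the `m`-cut of a class datum with `m ≠ 1` (Carlitz's `d = 1`). For the untwisted
datum `m = 1` (`χ = 1`, `k` odd, cut indices `a = n₀ f²`, `D' = −n₀`) the conductor `n₀` CAN be a prime `ℓ`, and then `k⁻¹B_{k,χ_{−ℓ}}`
has the denominator `ℓ` exactly when `(ℓ − 1) ∣ (ℓ−1)/2 + k` (so `ℓ ≤ 2k+1`): `H(3, 7) = −16/7`, `B_{5,χ_{−11}}/5 = −2550/11`. Here, for
odd `k ≥ 1` and `n₀ ≡ 3 (mod 4)` squarefree: §1 `ℓ ∤ n₀` ⟹ `‖L(1−k, χ_{−n₀})‖_ℓ ≤ 1` (auxiliary `c ≡ 1 (ℓ)`, `c ≡ −1 (n₀)`); §2 `ℓ ∣ n₀`,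
`(ℓ−1) ∤ k`, `(ℓ−1) ∤ 2k` (every `ℓ > 2k+1`, and the crux prime `ℓ = p`) ⟹ `‖L(1−k, χ_{−n₀})‖_ℓ ≤ 1` (auxiliary `c` a primitive root
mod `ℓ`, `≡ 1 (mod n₀/ℓ)`); §3 `ℓ ∣ n₀` ⟹ `‖ℓ·k·L(1−k, χ_{−n₀})‖_ℓ ≤ 1` always (Carlitz's `d = k·f`, the tree's level bound); §4
**`exists_multiplier_levelOne`** (`A = k · ∏_{3 ≤ ℓ ≤ 2k+1, ℓ ≠ p} ℓ`, `p ∤ A`, `‖A · H(k, n₀f²)‖_ℓ ≤ 1` for EVERY odd `ℓ`); §5 THE UNIFORM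
(INT) SOCKET for ALL class data **`exists_multiplier_cut`** (`∃ A, 0 < A ∧ p ∤ A ∧ ∀ odd ℓ, ∀ cut a, ‖A·H(k,a)‖_ℓ ≤ 1`; `A = 1` off
`m = 1`) and its `p`-divisible reading **`exists_multiplier_eq_prime_mul_cut`** (`‖H(k,a)‖_p < 1 ⟹ A·H(k,a) = p·y`, `2^j·y ∈ ℤ`) —
the `hcoef` input of w8 g8's `CuspGlue` file for the typed q-expansion principle (coefficients in `p·ℤ̄[1/N]`). beyond-print theorem: NO.
References: [Carlitz1959]; [BillereyMenares2018] proof of Lemma 3; [LangCyclotomic1990] Ch. 2 §2; [Cohen1975] §2; [Katz1973] §1.6.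
-/

set_option autoImplicit false
-- summit-side namespace `Summit.BirchSwinnertonDyer.BirchSwinnertonDyer.…` (single-conjunct summit, D-0017 layout)
set_option linter.dupNamespace false

noncomputable section

open scoped Classical NumberTheorySymbols
open NumberField DirichletCharacter
open Literature.NumberTheory.LFunctions Literature.NumberTheory.ModularForms.CohenEisenstein Literature.NumberTheory.EllipticCurves
  Literature.NumberTheory.Congruences

namespace Summit.BirchSwinnertonDyer.BirchSwinnertonDyer.Theorems.PrintCFram.CohenCut

open Summit.BirchSwinnertonDyer.BirchSwinnertonDyer.Theorems.PrintCFram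

/-! ## §0 The Kronecker symbol `χ_{−n₀} = J(· | n₀)` as an `n₀`-periodic multiplicative `ℤ_ℓ`-valued function -/

section Values

variable {ℓ : ℕ} [hℓ : Fact ℓ.Prime] {n₀ : ℕ}

/-- `χ_{−n₀}(c) = J(c | n₀)` for `n₀ ≡ 3 (mod 4)` (`−n₀ ≡ 1 (mod 4)`). [cite: MontgomeryVaughan2007, Thm. 9.13] -/
theorem chiDisc_neg_eq_jacobiSym (h4 : n₀ % 4 = 3) (c : ℕ) : chiDisc (-(n₀ : ℤ)) c = J((c : ℤ) | n₀) := by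
  rw [chiDisc_of_emod_four_eq_one (by omega), Int.natAbs_neg, Int.natAbs_natCast]

omit hℓ in
/-- `(−n₀).natAbs = n₀`. [folklore] -/
private theorem natAbs_neg_natCast (n₀ : ℕ) : (-(n₀ : ℤ)).natAbs = n₀ := by
  rw [Int.natAbs_neg, Int.natAbs_natCast]

/-- `J(· | n₀)` is `n₀`-periodic. [folklore] -/
private theorem jacobiSym_add_self (c : ℕ) : J(((c + n₀ : ℕ) : ℤ) | n₀) = J((c : ℤ) | n₀) := by
  rw [jacobiSym.mod_left ((c + n₀ : ℕ) : ℤ), jacobiSym.mod_left (c : ℤ)]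
  congr 1
  push_cast
  rw [show (c : ℤ) + n₀ = c + n₀ * 1 by ring, Int.add_mul_emod_self_left]

/-- An integer prime to `ℓ` has norm `1` in `ℚ_ℓ`. [folklore] -/
private theorem norm_intCast_eq_one_of_not_dvd {z : ℤ} (h : ¬ (ℓ : ℤ) ∣ z) : ‖(z : ℚ_[ℓ])‖ = 1 :=
  le_antisymm (Padic.norm_int_le_one z) (not_lt.mp fun h' ↦ h (Padic.norm_intCast_lt_one_iff.mp h'))

/-- `c ≡ 1 (mod ℓ)` makes `1 + c^k ≡ 2` an `ℓ`-adic unit for odd `ℓ`. [folklore] -/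
private theorem norm_one_add_pow_eq_one' (hℓ2 : ℓ ≠ 2) {c : ℕ} (hc1 : (c : ZMod ℓ) = 1) (k : ℕ) :
    ‖(1 : ℚ_[ℓ]) + (c : ℚ_[ℓ]) ^ k‖ = 1 := by
  have h2 : ¬ ((ℓ : ℤ) ∣ (1 + (c : ℤ) ^ k)) := by
    intro h
    rw [← ZMod.intCast_zmod_eq_zero_iff_dvd] at h
    push_cast at h
    rw [hc1, one_pow] at h
    have h2' : (2 : ZMod ℓ) = 0 := by rw [← h]; norm_num
    have : ((2 : ℕ) : ZMod ℓ) = 0 := by exact_mod_cast h2'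
    rw [ZMod.natCast_eq_zero_iff] at this
    exact hℓ2 ((Nat.prime_dvd_prime_iff_eq hℓ.out Nat.prime_two).mp this)
  have h := norm_intCast_eq_one_of_not_dvd h2
  push_cast at h
  exact h

end Values

/-! ## §1–§3 `L(1 − k, χ_{−n₀})` at an odd prime `ℓ` -/

section LValue

variable {ℓ : ℕ} [hℓ : Fact ℓ.Prime] {n₀ k : ℕ}

/-- The common packaging: an auxiliary `c` prime to `n₀ℓ` with `J(cx | n₀) = J(c|n₀)J(x|n₀)` (automatic) and a unit
`1 − J(c | n₀)c^k` gives `‖L(1−k, χ_{−n₀})‖_ℓ ≤ 1`. [cite: LangCyclotomic1990, Ch. 2 §2, Thm. 2.4 (PDF p. 38)] -/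
theorem norm_lValueDisc_neg_le_one_of_unit (hℓ2 : ℓ ≠ 2) (hsq : Squarefree n₀) (h4 : n₀ % 4 = 3) (hk : 1 ≤ k) {c : ℕ}
    (hc : c.Coprime (n₀ * ℓ)) (hu : ‖1 - (J((c : ℤ) | n₀) : ℚ_[ℓ]) * (c : ℚ_[ℓ]) ^ k‖ = 1) :
    ‖((lValueDisc k (-(n₀ : ℤ)) : ℚ) : ℚ_[ℓ])‖ ≤ 1 := by
  haveI : NeZero (-(n₀ : ℤ)).natAbs := ⟨by rw [natAbs_neg_natCast]; exact hsq.ne_zero⟩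
  set θ : ℕ → ℤ_[ℓ] := fun b ↦ ((chiDisc (-(n₀ : ℤ)) b : ℤ) : ℤ_[ℓ]) with hθ_def
  have hθ : ∀ b, θ (b + (-(n₀ : ℤ)).natAbs) = θ b := fun b ↦ by
    simp only [hθ_def]
    rw [natAbs_neg_natCast, chiDisc_neg_eq_jacobiSym h4, chiDisc_neg_eq_jacobiSym h4, jacobiSym_add_self]
  have hθc : ∀ x, θ (c * x) = θ c * θ x := fun x ↦ by
    simp only [hθ_def]
    rw [chiDisc_neg_eq_jacobiSym h4, chiDisc_neg_eq_jacobiSym h4, chiDisc_neg_eq_jacobiSym h4, Nat.cast_mul,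
      jacobiSym.mul_left, Int.cast_mul]
  have hc' : c.Coprime ((-(n₀ : ℤ)).natAbs * ℓ) := by rw [natAbs_neg_natCast]; exact hc
  have hθval : ((θ c : ℤ_[ℓ]) : ℚ_[ℓ]) = (J((c : ℤ) | n₀) : ℚ_[ℓ]) := by
    simp only [hθ_def, PadicInt.coe_intCast, chiDisc_neg_eq_jacobiSym h4]
  have hint := CarlitzIntegrality.norm_sum_mul_bernoulliDist_div_le_one_of_unit (N := (-(n₀ : ℤ)).natAbs)
    hℓ2 hc' hθ hθc hk (by rw [hθval]; exact hu)
  have hsum : ∑ b : ZMod (-(n₀ : ℤ)).natAbs, ((θ b.val : ℤ_[ℓ]) : ℚ_[ℓ]) *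
      ((bernoulliDist k (-(n₀ : ℤ)).natAbs b : ℚ) : ℚ_[ℓ]) = ((bernoulliDisc k (-(n₀ : ℤ)) : ℚ) : ℚ_[ℓ]) := by
    rw [ratCast_bernoulliDisc_eq_sum hk]
    refine Finset.sum_congr rfl fun b _ ↦ ?_
    simp only [hθ_def, PadicInt.coe_intCast]
  rw [hsum] at hint
  rw [lValueDisc, Rat.cast_div, Rat.cast_neg, Rat.cast_natCast, neg_div, norm_neg, div_eq_inv_mul]
  exact hint

/-- **§1 `ℓ ∤ n₀`: `‖L(1 − k, χ_{−n₀})‖_ℓ ≤ 1`** (`ℓ` odd, `k ≥ 1`, `n₀ ≡ 3 (mod 4)` squarefree): the auxiliary `c ≡ 1 (mod ℓ)`,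
`c ≡ −1 (mod n₀)` has `J(c | n₀) = J(−1 | n₀) = −1`. [cite: BillereyMenares2018, proof of Lemma 3 (Carlitz's theorem, arXiv p. 5)] -/
theorem norm_lValueDisc_neg_le_one_of_not_dvd (hℓ2 : ℓ ≠ 2) (hsq : Squarefree n₀) (h4 : n₀ % 4 = 3) (hk : 1 ≤ k)
    (hℓn : ¬ ℓ ∣ n₀) : ‖((lValueDisc k (-(n₀ : ℤ)) : ℚ) : ℚ_[ℓ])‖ ≤ 1 := by
  have hco : ℓ.Coprime n₀ := (hℓ.out.coprime_iff_not_dvd).mpr hℓn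
  obtain ⟨c, hc1, hc2⟩ := Nat.chineseRemainder hco 1 (n₀ - 1)
  have hcℓ : c.Coprime ℓ := by rw [Nat.Coprime, hc1.gcd_eq]; exact Nat.coprime_one_left _
  have hcn : c.Coprime n₀ := by
    rw [Nat.Coprime, hc2.gcd_eq]
    have h := (Nat.coprime_self_add_left (m := n₀ - 1) (n := 1)).mpr (Nat.coprime_one_left _)
    rw [Nat.sub_add_cancel (show 1 ≤ n₀ by omega)] at h
    exact Nat.coprime_comm.mp h
  have hJ : J((c : ℤ) | n₀) = -1 := by
    rw [jacobiSym.mod_left, show (c : ℤ) % (n₀ : ℤ) = ((n₀ - 1 : ℕ) : ℤ) % (n₀ : ℤ) by exact_mod_cast hc2,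
      ← jacobiSym.mod_left, jacobiSym_pred_eq_neg_one h4]
  have hcℓ1 : (c : ZMod ℓ) = 1 := by
    rw [(ZMod.natCast_eq_natCast_iff _ _ _).mpr hc1, Nat.cast_one]
  refine norm_lValueDisc_neg_le_one_of_unit hℓ2 hsq h4 hk (Nat.Coprime.mul_right hcn hcℓ) ?_
  rw [hJ, Int.cast_neg, Int.cast_one, neg_one_mul, sub_neg_eq_add]
  exact norm_one_add_pow_eq_one' hℓ2 hcℓ1 k

/-- **§2 `ℓ ∣ n₀`, `(ℓ−1) ∤ k`, `(ℓ−1) ∤ 2k`: `‖L(1 − k, χ_{−n₀})‖_ℓ ≤ 1`** (`ℓ` odd, `k ≥ 1`, `n₀ ≡ 3 (mod 4)` squarefree). The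
auxiliary `c` is a primitive root mod `ℓ` with `c ≡ 1 (mod n₀/ℓ)`: `J(c | n₀) = J(c | ℓ) = ±1`, and `1 − c^k` resp. `1 + c^k` (which
divides `1 − c^{2k}`) is prime to `ℓ` because `c^j ≢ 1 (mod ℓ)` unless `(ℓ−1) ∣ j`. Covers every `ℓ > 2k + 1`, and the crux prime
`ℓ = p` for the class weights `k ∈ {(p+1)/4, (3p−1)/4}`. [cite: BillereyMenares2018, proof of Lemma 3 (Carlitz's theorem, arXiv p. 5)] -/
theorem norm_lValueDisc_neg_le_one_of_dvd_of_not_dvd (hℓ2 : ℓ ≠ 2) (hsq : Squarefree n₀) (h4 : n₀ % 4 = 3) (hk : 1 ≤ k)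
    (hℓn : ℓ ∣ n₀) (hk1 : ¬ (ℓ - 1) ∣ k) (hk2 : ¬ (ℓ - 1) ∣ 2 * k) :
    ‖((lValueDisc k (-(n₀ : ℤ)) : ℚ) : ℚ_[ℓ])‖ ≤ 1 := by
  obtain ⟨n₁, hn₁⟩ := hℓn
  have hn₁0 : n₁ ≠ 0 := by rintro rfl; rw [mul_zero] at hn₁; omega
  haveI : NeZero n₁ := ⟨hn₁0⟩
  have hℓn₁ : ¬ ℓ ∣ n₁ := by
    rintro ⟨t, rfl⟩
    exact Nat.squarefree_iff_prime_squarefree.mp hsq ℓ hℓ.out ⟨t, by rw [hn₁]; ring⟩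
  have hN : n₁.Coprime ℓ := Nat.Coprime.symm ((hℓ.out.coprime_iff_not_dvd).mpr hℓn₁)
  obtain ⟨c, hc, hc1, hck⟩ := CharacterTwist.exists_auxiliary (p := ℓ) hN
  have hcℓ : c.Coprime ℓ := (Nat.coprime_mul_iff_right.mp hc).2
  have hcn₁ : c.Coprime n₁ := (Nat.coprime_mul_iff_right.mp (Nat.coprime_mul_iff_right.mp hc).1).1
  have hcn : c.Coprime (n₀ * ℓ) := by rw [hn₁]; exact (hcℓ.mul_right hcn₁).mul_right hcℓ
  -- `c^j ≢ 1 (mod ℓ)` unless `(ℓ − 1) ∣ j`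
  have hpow : ∀ j : ℕ, ¬ (ℓ - 1) ∣ j → ¬ ((ℓ : ℤ) ∣ (1 - (c : ℤ) ^ j)) := by
    intro j hj h
    have hℓ1 : 1 ≤ ℓ - 1 := by have := hℓ.out.two_le; omega
    have hcu : IsUnit (c : ZMod ℓ) := (ZMod.isUnit_iff_coprime c ℓ).mpr hcℓ
    have hF : (c : ZMod ℓ) ^ (ℓ - 1) = 1 := ZMod.pow_card_sub_one_eq_one (fun h0 ↦ by
      rw [h0] at hcu; exact not_isUnit_zero hcu)
    have hred : (c : ZMod ℓ) ^ j = (c : ZMod ℓ) ^ (j % (ℓ - 1)) := by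
      conv_lhs => rw [← Nat.mod_add_div j (ℓ - 1), pow_add, pow_mul, hF, one_pow, mul_one]
    have hj' : 0 < j % (ℓ - 1) ∧ j % (ℓ - 1) < ℓ - 1 :=
      ⟨Nat.pos_of_ne_zero fun h0 ↦ hj (Nat.dvd_of_mod_eq_zero h0), Nat.mod_lt _ hℓ1⟩
    refine hck _ hj'.1 hj'.2 ?_
    rw [← ZMod.intCast_zmod_eq_zero_iff_dvd] at h ⊢
    push_cast at h ⊢
    rwa [← hred]
  -- `J(c | n₀) = J(c | ℓ) = ±1`
  have hJn₁ : J((c : ℤ) | n₁) = 1 := by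
    have h1 : c ≡ 1 [MOD n₁] := (ZMod.natCast_eq_natCast_iff _ _ _).mp (by rw [hc1, Nat.cast_one])
    rw [jacobiSym.mod_left, show (c : ℤ) % (n₁ : ℤ) = ((1 : ℕ) : ℤ) % (n₁ : ℤ) by exact_mod_cast h1,
      ← jacobiSym.mod_left, Nat.cast_one, jacobiSym.one_left]
  haveI : NeZero ℓ := ⟨hℓ.out.ne_zero⟩
  have hJ : J((c : ℤ) | n₀) = J((c : ℤ) | ℓ) := by
    rw [hn₁, jacobiSym.mul_right, hJn₁, mul_one]
  refine norm_lValueDisc_neg_le_one_of_unit hℓ2 hsq h4 hk hcn ?_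
  rw [hJ]
  rcases jacobiSym.eq_one_or_neg_one (a := (c : ℤ)) (b := ℓ) (by
      rw [Int.gcd_natCast_natCast]; exact hcℓ) with h1 | h1
  · rw [h1, Int.cast_one, one_mul]
    have h := norm_intCast_eq_one_of_not_dvd (hpow k hk1)
    push_cast at h
    exact h
  · rw [h1, Int.cast_neg, Int.cast_one, neg_one_mul, sub_neg_eq_add]
    -- `ℓ ∣ 1 + c^k` would give `ℓ ∣ (1 + c^k)(1 − c^k) = 1 − c^{2k}`
    have h2 : ¬ ((ℓ : ℤ) ∣ (1 + (c : ℤ) ^ k)) := by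
      intro h
      refine hpow (2 * k) hk2 ?_
      rw [show (1 : ℤ) - (c : ℤ) ^ (2 * k) = (1 + (c : ℤ) ^ k) * (1 - (c : ℤ) ^ k) by ring]
      exact h.mul_right _
    have h := norm_intCast_eq_one_of_not_dvd h2
    push_cast at h
    exact h

/-- **§3 `ℓ ∣ n₀`: `‖ℓ · k · L(1 − k, χ_{−n₀})‖_ℓ ≤ 1` ALWAYS** (`ℓ` odd, `k ≥ 1`, `n₀ ≡ 3 (mod 4)` squarefree) — Carlitz's `d = k·f`
for a prime conductor: the tree's level bound `‖n₀ · B_{k,χ_{−n₀}}‖_ℓ ≤ 1` (`CarlitzIntegrality.norm_mul_sum_mul_bernoulliDist_le_one_of_dvd`,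
auxiliary `c = 1 + n₀` and lifting the exponent), with `‖n₀‖_ℓ = ‖ℓ‖_ℓ` as `n₀` is squarefree. Sharp: `7 · B_{3,χ_{−7}} = 48`.
[cite: BillereyMenares2018, proof of Lemma 3 (Carlitz's theorem, arXiv p. 5)] -/
theorem norm_mul_lValueDisc_neg_le_one_of_dvd (hℓ2 : ℓ ≠ 2) (hsq : Squarefree n₀) (h4 : n₀ % 4 = 3) (hk : 1 ≤ k)
    (hℓn : ℓ ∣ n₀) : ‖((((ℓ * k : ℕ) : ℚ) * lValueDisc k (-(n₀ : ℤ)) : ℚ) : ℚ_[ℓ])‖ ≤ 1 := by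
  haveI : NeZero (-(n₀ : ℤ)).natAbs := ⟨by rw [natAbs_neg_natCast]; exact hsq.ne_zero⟩
  obtain ⟨n₁, hn₁⟩ := hℓn
  have hℓn₁ : ¬ ℓ ∣ n₁ := by
    rintro ⟨t, rfl⟩
    exact Nat.squarefree_iff_prime_squarefree.mp hsq ℓ hℓ.out ⟨t, by rw [hn₁]; ring⟩
  set θ : ℕ → ℤ_[ℓ] := fun b ↦ ((chiDisc (-(n₀ : ℤ)) b : ℤ) : ℤ_[ℓ]) with hθ_def
  have hθ : ∀ b, θ (b + (-(n₀ : ℤ)).natAbs) = θ b := fun b ↦ by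
    simp only [hθ_def]
    rw [natAbs_neg_natCast, chiDisc_neg_eq_jacobiSym h4, chiDisc_neg_eq_jacobiSym h4, jacobiSym_add_self]
  have hθ1 : θ 1 = 1 := by
    simp only [hθ_def]
    rw [chiDisc_neg_eq_jacobiSym h4, Nat.cast_one, jacobiSym.one_left, Int.cast_one]
  have hint := CarlitzIntegrality.norm_mul_sum_mul_bernoulliDist_le_one_of_dvd (N := (-(n₀ : ℤ)).natAbs) hℓ2
    (by rw [natAbs_neg_natCast, hn₁]; exact dvd_mul_right ℓ n₁) hθ hθ1 hk
  have hsum : ∑ b : ZMod (-(n₀ : ℤ)).natAbs, ((θ b.val : ℤ_[ℓ]) : ℚ_[ℓ]) *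
      ((bernoulliDist k (-(n₀ : ℤ)).natAbs b : ℚ) : ℚ_[ℓ]) = ((bernoulliDisc k (-(n₀ : ℤ)) : ℚ) : ℚ_[ℓ]) := by
    rw [ratCast_bernoulliDisc_eq_sum hk]
    refine Finset.sum_congr rfl fun b _ ↦ ?_
    simp only [hθ_def, PadicInt.coe_intCast]
  rw [hsum, natAbs_neg_natCast, norm_mul] at hint
  -- `‖n₀‖_ℓ = ‖ℓ‖_ℓ` and `‖ℓ k · (−B/k)‖ = ‖ℓ‖ ‖B‖`
  have hn₀ : ‖(n₀ : ℚ_[ℓ])‖ = ‖(ℓ : ℚ_[ℓ])‖ := by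
    have h1 : ‖(n₁ : ℚ_[ℓ])‖ = 1 := by
      have h := norm_intCast_eq_one_of_not_dvd (z := (n₁ : ℤ)) (by exact_mod_cast hℓn₁)
      rwa [Int.cast_natCast] at h
    rw [hn₁, Nat.cast_mul, norm_mul, h1, mul_one]
  have hk0 : (k : ℚ_[ℓ]) ≠ 0 := by exact_mod_cast (show k ≠ 0 by omega)
  have e : (((ℓ * k : ℕ) : ℚ) * lValueDisc k (-(n₀ : ℤ)) : ℚ) = -((ℓ : ℚ) * bernoulliDisc k (-(n₀ : ℤ))) := by
    rw [lValueDisc]; push_cast; field_simp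
  rw [e, Rat.cast_neg, norm_neg, Rat.cast_mul, Rat.cast_natCast, norm_mul, ← hn₀]
  exact hint

end LValue

/-! ## §4 The untwisted datum `m = 1`: a UNIFORM multiplier `A` with `p ∤ A` -/

section LevelOne

variable {p : ℕ} [hp : Fact p.Prime] {k : ℕ}

/-- Cohen's formula at an `m = 1` cut index: `H(k, n₀ f²) = L(1 − k, χ_{−n₀}) · T_k(−n₀, f)` for ODD `k`
(`(−1)^k · n₀f² = (−n₀)·f²`, `−n₀` a fundamental discriminant). [cite: Cohen1975, §2 (definition of H(r, N))] -/
theorem cohenH_levelOne_eq {n₀ f : ℕ} (hko : Odd k) (hsq : Squarefree n₀) (h4 : n₀ % 4 = 3) (hf : 0 < f) :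
    cohenH k (n₀ * f ^ 2) = lValueDisc k (-(n₀ : ℤ)) * cohenT k (-(n₀ : ℤ)) f := by
  refine cohenH_eq ⟨Or.inr (Or.inl ⟨by omega, ?_, by omega⟩), hf, ?_⟩
  · exact Int.squarefree_natAbs.mp (by rw [Int.natAbs_neg, Int.natAbs_natCast]; exact hsq)
  · rw [hko.neg_one_pow]; push_cast; ring

/-- **THE UNIFORM MULTIPLIER FOR `m = 1`.** For the crux prime `p` and an odd weight `k ≥ 1` with `p ∤ k`, `(p−1) ∤ k`, `(p−1) ∤ 2k`
(all automatic for the class weights `k ∈ {(p+1)/4, (3p−1)/4}`, `p ≡ 3 (mod 4)`, `p ≥ 7`) there is `A ∈ ℕ` with `p ∤ A`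
(namely `A = k · ∏_{ℓ prime, 3 ≤ ℓ ≤ 2k+1, ℓ ≠ p} ℓ`) such that `‖A · H(k, n₀f²)‖_ℓ ≤ 1` for EVERY odd prime `ℓ` and every
`m = 1` cut index (`n₀ ≡ 3 (mod 4)` squarefree, `f ≥ 1`): §1 off the conductor, §2 at `ℓ ∣ n₀` with `(ℓ−1) ∤ k, 2k` (all
`ℓ > 2k+1` and `ℓ = p`), §3's `ℓ·k` at the finitely many remaining `ℓ ≤ 2k+1`, `ℓ ≠ p`.
[cite: Carlitz1959, Theorem (d = k·f for a prime conductor f)] [cite: BillereyMenares2018, proof of Lemma 3 (arXiv p. 5)] -/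
theorem exists_multiplier_levelOne (hk : 1 ≤ k) (hko : Odd k) (hpk : ¬ p ∣ k) (hkp1 : ¬ (p - 1) ∣ k)
    (hkp2 : ¬ (p - 1) ∣ 2 * k) :
    ∃ A : ℕ, 0 < A ∧ ¬ p ∣ A ∧ ∀ (ℓ : ℕ) [Fact ℓ.Prime], ℓ ≠ 2 → ∀ n₀ f : ℕ, Squarefree n₀ → n₀ % 4 = 3 → 0 < f →
      ‖((((A : ℚ) * cohenH k (n₀ * f ^ 2) : ℚ)) : ℚ_[ℓ])‖ ≤ 1 := by
  set S : Finset ℕ := (Finset.range (2 * k + 2)).filter (fun ℓ ↦ ℓ.Prime ∧ ℓ ≠ 2 ∧ ℓ ≠ p) with hS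
  have hSprime : ∀ ℓ ∈ S, ℓ.Prime := fun ℓ hℓ ↦ ((Finset.mem_filter.mp hℓ).2).1
  refine ⟨k * ∏ ℓ ∈ S, ℓ, Nat.mul_pos (by omega) (Finset.prod_pos fun ℓ hℓ ↦ (hSprime ℓ hℓ).pos), ?_, ?_⟩
  · -- `p ∤ A`
    intro h
    rcases (Nat.Prime.dvd_mul hp.out).mp h with h | h
    · exact hpk h
    · obtain ⟨ℓ, hℓS, hℓ⟩ := (Prime.dvd_finsetProd_iff hp.out.prime _).mp h
      have := ((Finset.mem_filter.mp hℓS).2).2.2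
      exact this ((Nat.prime_dvd_prime_iff_eq hp.out (hSprime ℓ hℓS)).mp hℓ).symm
  · intro ℓ hℓ' hℓ2 n₀ f hsq h4 hf
    rw [cohenH_levelOne_eq hko hsq h4 hf]
    have hT : ‖((cohenT k (-(n₀ : ℤ)) f : ℤ) : ℚ_[ℓ])‖ ≤ 1 := Padic.norm_int_le_one _
    have hnat : ∀ n : ℕ, ‖((n : ℚ) : ℚ_[ℓ])‖ ≤ 1 := fun n ↦ by
      rw [Rat.cast_natCast]; exact_mod_cast Padic.norm_int_le_one (p := ℓ) (n : ℤ)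
    by_cases hbad : ℓ ∣ n₀ ∧ ¬ (¬ (ℓ - 1) ∣ k ∧ ¬ (ℓ - 1) ∣ 2 * k)
    · -- `ℓ ∣ n₀` and `(ℓ − 1) ∣ k` or `(ℓ−1) ∣ 2k`: then `ℓ ≤ 2k + 1`, `ℓ ≠ p`, so `ℓ · k ∣ A`
      obtain ⟨hℓn, hdiv⟩ := hbad
      have hℓle : ℓ < 2 * k + 2 := by
        have h2k : 0 < 2 * k := by omega
        by_cases h1 : (ℓ - 1) ∣ k
        · have := Nat.le_of_dvd (by omega) h1; omega
        · have h2 : (ℓ - 1) ∣ 2 * k := by by_contra h2; exact hdiv ⟨h1, h2⟩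
          have := Nat.le_of_dvd h2k h2; omega
      have hℓp : ℓ ≠ p := by rintro rfl; exact hdiv ⟨hkp1, hkp2⟩
      have hℓS : ℓ ∈ S := Finset.mem_filter.mpr ⟨Finset.mem_range.mpr hℓle, hℓ'.out, hℓ2, hℓp⟩
      have hA : k * ∏ ℓ' ∈ S, ℓ' = (∏ ℓ' ∈ S.erase ℓ, ℓ') * (ℓ * k) := by
        rw [← Finset.mul_prod_erase S (fun x ↦ x) hℓS]; ring
      have hmain := norm_mul_lValueDisc_neg_le_one_of_dvd hℓ2 hsq h4 hk hℓn
      have hrest := hnat (∏ ℓ' ∈ S.erase ℓ, ℓ')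
      have hA' : ((k : ℚ_[ℓ]) * ∏ x ∈ S, (x : ℚ_[ℓ])) = (∏ ℓ' ∈ S.erase ℓ, (ℓ' : ℚ_[ℓ])) * ((ℓ : ℚ_[ℓ]) * (k : ℚ_[ℓ])) := by
        have h := congrArg (fun n : ℕ ↦ (n : ℚ_[ℓ])) hA
        push_cast at h
        exact h
      push_cast at hmain hrest ⊢
      rw [hA']
      have e : (∏ ℓ' ∈ S.erase ℓ, (ℓ' : ℚ_[ℓ])) * ((ℓ : ℚ_[ℓ]) * (k : ℚ_[ℓ])) *
          (((lValueDisc k (-(n₀ : ℤ)) : ℚ) : ℚ_[ℓ]) * ((cohenT k (-(n₀ : ℤ)) f : ℤ) : ℚ_[ℓ])) =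
          (∏ ℓ' ∈ S.erase ℓ, (ℓ' : ℚ_[ℓ])) *
            (((ℓ : ℚ_[ℓ]) * (k : ℚ_[ℓ]) * ((lValueDisc k (-(n₀ : ℤ)) : ℚ) : ℚ_[ℓ])) *
              ((cohenT k (-(n₀ : ℤ)) f : ℤ) : ℚ_[ℓ])) := by ring
      rw [e]
      exact (norm_mul_le _ _).trans (mul_le_one₀ hrest (norm_nonneg _)
        ((norm_mul_le _ _).trans (mul_le_one₀ hmain (norm_nonneg _) hT)))
    · -- otherwise `L(1−k, χ_{−n₀})` itself is `ℓ`-integral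
      have hL : ‖((lValueDisc k (-(n₀ : ℤ)) : ℚ) : ℚ_[ℓ])‖ ≤ 1 := by
        by_cases hℓn : ℓ ∣ n₀
        · have hgood : ¬ (ℓ - 1) ∣ k ∧ ¬ (ℓ - 1) ∣ 2 * k := by
            by_contra hgood; exact hbad ⟨hℓn, hgood⟩
          exact norm_lValueDisc_neg_le_one_of_dvd_of_not_dvd hℓ2 hsq h4 hk hℓn hgood.1 hgood.2
        · exact norm_lValueDisc_neg_le_one_of_not_dvd hℓ2 hsq h4 hk hℓn
      have hAle := hnat (k * ∏ ℓ' ∈ S, ℓ')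
      push_cast at hAle ⊢
      exact (norm_mul_le _ _).trans (mul_le_one₀ hAle (norm_nonneg _)
        ((norm_mul_le _ _).trans (mul_le_one₀ hL (norm_nonneg _) hT)))

end LevelOne

/-! ## §5 THE UNIFORM (INT) SOCKET for every class datum -/

section Uniform

variable {p : ℕ} [hp : Fact p.Prime] {m : ℕ} [NeZero m] {χ : DirichletCharacter ℚ_[p] m} {k : ℕ}

omit hp [NeZero m] in
/-- The class weights satisfy `(p − 1) ∤ 2k` (and `k ≤ p − 2`, so `(p−1) ∤ k`, `p ∤ k`). [folklore] -/
private theorem not_dvd_two_mul_classWeight (hp4 : p % 4 = 3) (h7 : 7 ≤ p) (hk : k = (p + 1) / 4 ∨ k = (3 * p - 1) / 4) :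
    ¬ (p - 1) ∣ 2 * k := by
  rintro ⟨t, ht⟩
  rcases t with _ | _ | t
  · rcases hk with rfl | rfl <;> omega
  · rcases hk with rfl | rfl <;> omega
  · have : (p - 1) * (t + 1 + 1) ≥ (p - 1) * 2 := Nat.mul_le_mul_left _ (by omega)
    rcases hk with rfl | rfl <;> omega

/-- **THE UNIFORM (INT) SOCKET.** For every class datum of the crux (`p ≡ 3 (mod 4)`, `p ≥ 7`, `χ` primitive quadratic modulo `m`,
`k ∈ {(p+1)/4, (3p−1)/4}`, parity clause `χ(−1)(−1)^k = −1`) there is `A ∈ ℕ`, `A > 0`, `p ∤ A`, such that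
`‖A · H(k, a)‖_ℓ ≤ 1` for EVERY ODD prime `ℓ` and EVERY index `a` of the `m`-cut (`m ∣ a`, `a/m ≡ 3 (mod 4)`, Jacobi clauses):
`A = 1` when `m ≠ 1` (part 1, Carlitz's `d = 1`), `A = k·∏_{3 ≤ ℓ ≤ 2k+1, ℓ ≠ p} ℓ` when `m = 1` (`exists_multiplier_levelOne`).
This is the integrality input of the q-expansion-principle step of the cusp glue, in the shape posted on STATUS 04:17:35Z /
acknowledged by w8 g8 04:30:22Z. [cite: Carlitz1959, Theorem (integrality of d·k⁻¹B_{k,χ})] [cite: BillereyMenares2018, proof of Lemma 3 (arXiv p. 5)] -/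
theorem exists_multiplier_cut (hp4 : p % 4 = 3) (h7 : 7 ≤ p) (hχ : χ.IsPrimitive) (hχq : χ.IsQuadratic)
    (hk : k = (p + 1) / 4 ∨ k = (3 * p - 1) / 4) (hpar : χ (-1) * (-1) ^ k = -1) :
    ∃ A : ℕ, 0 < A ∧ ¬ p ∣ A ∧ ∀ (ℓ : ℕ) [Fact ℓ.Prime], ℓ ≠ 2 → ∀ a : ℕ, m ∣ a → a / m % 4 = 3 →
      (∀ q : ℕ, q.Prime → q ∣ m → q ≠ 2 → jacobiSym (-((a / m : ℕ) : ℤ)) q = 1) →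
      ‖((((A : ℚ) * cohenH k a : ℚ)) : ℚ_[ℓ])‖ ≤ 1 := by
  have hk1 : 1 ≤ k := by rcases hk with rfl | rfl <;> omega
  by_cases hm1 : m = 1
  · subst hm1
    -- `χ = 1`, `k` odd
    have hχ1 : χ (-1) = 1 := by rw [show (-1 : ZMod 1) = 1 from Subsingleton.elim _ _, map_one]
    rw [hχ1, one_mul] at hpar
    have hko : Odd k := (neg_one_pow_eq_neg_one_iff_odd (by norm_num)).mp hpar
    have hpk : ¬ p ∣ k := fun h ↦ by have := Nat.le_of_dvd (by omega) h; rcases hk with rfl | rfl <;> omega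
    have hkp1 : ¬ (p - 1) ∣ k := fun h ↦ by have := Nat.le_of_dvd (by omega) h; rcases hk with rfl | rfl <;> omega
    obtain ⟨A, hA0, hpA, hA⟩ := exists_multiplier_levelOne (p := p) hk1 hko hpk hkp1 (not_dvd_two_mul_classWeight hp4 h7 hk)
    refine ⟨A, hA0, hpA, fun ℓ _ hℓ2 a hma ha4 _ ↦ ?_⟩
    obtain ⟨n₀, f, hsq, h4, hf, rfl, -⟩ := exists_eq_mul_sq_of_cut hma ha4
    rw [one_mul]
    exact hA ℓ hℓ2 n₀ f hsq h4 hf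
  · refine ⟨1, one_pos, fun h ↦ hp.out.one_lt.ne' (Nat.dvd_one.mp h), fun ℓ _ hℓ2 a hma ha4 hJ ↦ ?_⟩
    rw [Nat.cast_one, one_mul]
    exact norm_ratCast_cohenH_le_one_of_cut_of_odd_prime hℓ2 hm1 hχ hχq hk1 hpar hma ha4 hJ

/-- **THE UNIFORM (INT) SOCKET, `p`-divisible reading**: with `A` as in `exists_multiplier_cut`, every cut Cohen number with
`p ∣ H(k, a)` in `ℤ_p` (`‖H(k,a)‖_p < 1`, what `G = 0` says) satisfies `A · H(k, a) = p · y` with `2^j · y ∈ ℤ` — so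
`y ∈ ℤ̄[1/N]` for every even level `N` (`exists_isIntegral_pow_mul_of_two_pow_mul`), the hypothesis currency of the typed
q-expansion principle `Katz1973_qExpansionPrinciple_allCusps` for the vehicle `A · (cut Cohen form)`.
[cite: Carlitz1959, Theorem (integrality of d·k⁻¹B_{k,χ})] [cite: Katz1973, §1.6 Cor. 1.6.2] -/
theorem exists_multiplier_eq_prime_mul_cut (hp4 : p % 4 = 3) (h7 : 7 ≤ p) (hχ : χ.IsPrimitive) (hχq : χ.IsQuadratic)
    (hk : k = (p + 1) / 4 ∨ k = (3 * p - 1) / 4) (hpar : χ (-1) * (-1) ^ k = -1) :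
    ∃ A : ℕ, 0 < A ∧ ¬ p ∣ A ∧ ∀ a : ℕ, m ∣ a → a / m % 4 = 3 →
      (∀ q : ℕ, q.Prime → q ∣ m → q ≠ 2 → jacobiSym (-((a / m : ℕ) : ℤ)) q = 1) →
      ‖((cohenH k a : ℚ) : ℚ_[p])‖ < 1 →
      ∃ y : ℚ, (A : ℚ) * cohenH k a = p * y ∧ ∃ (j : ℕ) (z : ℤ), (2 : ℚ) ^ j * y = z := by
  have hp2 : p ≠ 2 := by omega
  obtain ⟨A, hA0, hpA, hA⟩ := exists_multiplier_cut hp4 h7 hχ hχq hk hpar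
  refine ⟨A, hA0, hpA, fun a hma ha4 hJ hlt ↦ exists_eq_prime_mul_of_norm_lt_one ?_ ?_⟩
  · rw [Rat.cast_mul, Rat.cast_natCast, norm_mul]
    refine (mul_le_of_le_one_left (norm_nonneg _) ?_).trans_lt hlt
    exact_mod_cast Padic.norm_int_le_one (p := p) (A : ℤ)
  · intro ℓ hℓ hdvd
    exact eq_two_of_dvd_den_of_forall_norm_le_one (fun ℓ' _ hℓ'2 ↦ hA ℓ' hℓ'2 a hma ha4 hJ) hℓ hdvd

end Uniform

end Summit.BirchSwinnertonDyer.BirchSwinnertonDyer.Theorems.PrintCFram.CohenCut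

end
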